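import Summits.ResolutionOfSingularities.ResolutionOfSingularities.Theorems.PurelyInseparableDim4ResConeTwoSlotRotationStep
import Summits.ResolutionOfSingularities.ResolutionOfSingularities.Theorems.PurelyInseparableDim4ResConeTwoSlotTailNoRotation
import Summits.ResolutionOfSingularities.ResolutionOfSingularities.Theorems.PurelyInseparableDim4ResConeLSectorRotation
import HarnessLib
import HarnessLib.Audit.Tags

/-!
# Purely inseparable four-folds — THE L-SECTOR OF THE TWO-SLOT TAIL IS EMPTY, ROTATIONS INCLUDED
# (cell `res-dim4-pi`, K2(p) lane, slice B brick K24a-L′, file 2 of 2)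

[OURS · counted 0 · cell `res-dim4-pi` · K2(p) lane (holder res-dim4-p-12 g3, «K24a-L′ = `no_twoSlot_tail_five_L`
WITHOUT `hslot`», bus 2026-08-29 04:35:53Z; riders of res-dim4-crit-4 g4 04:39:55Z); seat res-dim4-p-2 g5 over
file 1 `…ResConeTwoSlotRotationStep`, res-dim4-p-1 g4's `…TwoSlotTailNoRotation` (template `no_twoSlot_tail_five_of_slot_L`),
the holder's R2 `…LSectorKill`, res-dim4-p-9 g3's R2b `…LSectorRotation`, res-dim4-p-2 g3's `chain_powerCone_package`
and the free-tail theorem `FreeTailProof.noIsolatedFreeTailAt_self`.]  Nothing here proves K2(p)/K2(5),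
`NoIsolatedTrap p p` or resolution of singularities in dimension ≥ 4 / characteristic `p`.  AI kernel work, weaker than
expert review.

THE REGIME.  (T2) of the light `d = 3` tail at `p = 5` (weights `≤ 1`, `|r| = 3`, orders `6`): an idle boundary letter
`ν` from `k₁` on, boundary `e_A + e_B + e_ν`, free letter `f`; SLOT steps (chart a slot, translation along `f`) and
ROTATIONS (chart `f`, exactly one slot lost and freed — file 1).  The L-SECTOR: the vertex form vanishes at the free
letter.  A step `k+1` is SATELLITE iff `j (k+1) ≠ j k ∧ b (k+1) (j k) = 0` (`FreeTail.IsSatellite`); in this regime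
that is (γ) «chart the other slot» or (δ) «rotation losing the other slot» (holder 04:35:53Z, re-derived by crit-4).

* §3 the two-step deaths at a satellite step: `false_of_slot_satellite_L` (after a slot step `A`: slot `B` = R2
  `not_isIsolated_after_lSector_change_of_forms`, rotation losing `B` = R2b (ii)
  `not_isIsolated_after_slot_rotation_of_forms`) and `false_of_rotation_satellite_L` (after a rotation losing `A`: slot
  `B` along the new free letter `A` = R2b (iii), rotation chart `A` losing `B` = R2b (iv), both
  `not_isIsolated_after_rotation_step_of_forms`; the direction equations force `cone_k = c·x_ν³` here).  All vanishing
  hypotheses of R2/R2b come from the direction equations + propagation of `chain_powerCone_package` — no separate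
  «rotation cone law» is needed at cone level.
* §4 **`no_twoSlot_tail_five_L`** — the L-sector branch WITHOUT `hslot` (and without `hborn`, `hT`): weights `≤ 1`
  (K26a `light_weights`, else ✗ FT), the L-sector persists (file 1), a satellite step `k ≥ k₁` exists
  (`FreeTailProof.noIsolatedFreeTailAt_self 5`), and `c (k+2)` is not isolated (§3).
* §4b/§5 `no_twoSlot_tail_five_of_slotT` / `no_light_powerCone_tail_three_five_of_slotT` — (T2) resp. the light `d = 3`
  tail DEAD ‖ K MODULO T-SECTOR ROTATIONS ONLY (`hslotT`; T-sector = p-1 g4's `no_twoSlot_tail_five_of_slot`); and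
  `no_light_powerCone_tail_three_five_of_T` — K27a `no_light_powerCone_tail_three_five_of` with its residual `hT2`
  reduced to the T-SECTOR (at `k₁` every vertex form charges every free letter; rotations still allowed there —
  res-dim4-p-1 g4's R1′).

[cite: CossartJannsenSaito2020, Thm. 3.10(4), Thm. 3.14, Thm. 9.3] [cite: HauserPerlega2019PRIMS, §2 (transform D' of D)]
bears_on: LADDER-RESOLUTION:D157-DOOR2 (res-dim4-pi · K2(p) · slice B · K24a-L′).  Supports
stmt-ResolutionOfSingularities-16155 (helper).
-/

set_option linter.dupNamespace false -- mandated namespace of this single-conjunct summit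

noncomputable section

namespace Summit.ResolutionOfSingularities.ResolutionOfSingularities.Theorems.PIDim4

namespace ResCone

open MvPolynomial Finset
open Literature.AlgebraicGeometry.Resolution
open Literature.AlgebraicGeometry.Resolution.CentreBlowup
open Literature.AlgebraicGeometry.Resolution.Hauser2010
open Literature.AlgebraicGeometry.Resolution.HauserPerlega2019

variable {K : Type} [Field K]

/-! ## 3. The two-step deaths at a satellite step -/

section Kills

variable [DecidableEq K]

/-- **DEATH AFTER A SLOT STEP.**  In the L-sector of the two-slot tail (`p = 5`, orders `6`, boundary `e_A + e_B + e_ν`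
at `k` and `k+1`, `x^r ∣ F`, power cones `a (Σ ℓᵢ xᵢ)^3` with the direction equations, propagation off the chart
and `ℓ` vanishing at the free letter of each time), a SLOT step `k` with chart `A` followed by a SATELLITE step
`k+1` (`j (k+1) ≠ A`, `b (k+1) A = 0`) makes `c (k+2)` non-isolated: slot `B` is the holder's R2
`not_isIsolated_after_lSector_change_of_forms`, the rotation losing `B` is R2b (ii)
`not_isIsolated_after_slot_rotation_of_forms`. [OURS] [cite: CossartJannsenSaito2020, Thm. 3.14] -/
theorem false_of_slot_satellite_L {c : ℕ → State K} {j : ℕ → Fin 4} {b : ℕ → Fin 4 → K}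
    (hw : FreeTail.IsWitnessedChain 5 c j b) {k : ℕ}
    (hord : ∀ m, k ≤ m → ordZero (c m).F = ((6 : ℕ) : ℕ∞))
    (hwt : ∀ m, k ≤ m → (∀ i, (c m).r i ≤ 1) ∧ (c m).r.degree = 3)
    (hdiv : ∀ m, ∀ d ∈ (c m).F.support, (c m).r ≤ d) {ν : Fin 4}
    (hidle : ∀ m, k ≤ m → 1 ≤ (c m).r ν ∧ j m ≠ ν ∧ b m ν = 0) {ℓ : ℕ → Fin 4 → K} {a0 : ℕ → K}
    (hform : ∀ m, k ≤ m → resForm (c m) = C (a0 m) * (∑ i, C (ℓ m i) * X i) ^ 3)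
    (hdir : ∀ m, k ≤ m → ℓ m (j m) + dotProduct (ℓ m) (b m) = 0)
    (hfree : ∀ m, k ≤ m → ∃ f, (c m).r f = 0 ∧ ℓ m f = 0)
    (hiso : IsIsolated 5 (c (k + 2)).F) {A B f : Fin 4} (hAB : A ≠ B) (hAν : A ≠ ν) (hAf : A ≠ f)
    (hBν : B ≠ ν) (hBf : B ≠ f) (hνf : ν ≠ f)
    (hrk : (c k).r = Finsupp.single A 1 + Finsupp.single B 1 + Finsupp.single ν 1) (hjA : j k = A)
    (hsat : FreeTail.IsSatellite j b k) : False := by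
  have hq := triple_apply hAB hAν hAf hBν hBf hνf
  have hdeg : ∀ m, k ≤ m → (c (m + 1)).r.degree = (c m).r.degree := fun m hm => by
    rw [(hwt (m + 1) (by omega)).2, (hwt m hm).2]
  -- step `k`: slot `A`, translation along `f`
  obtain ⟨hrk1, hbk⟩ := r_succ_of_slot' 5 hw (hord k le_rfl) (hdeg k le_rfl) hAB hAν hAf hBν hBf hνf hrk
    (Or.inl hjA)
  have hℓf : ∀ m, k ≤ m → (c m).r = Finsupp.single A 1 + Finsupp.single B 1 + Finsupp.single ν 1 → ℓ m f = 0 :=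
    fun m hm hrm => by
      obtain ⟨f', hrf', hℓf'⟩ := hfree m hm
      rwa [eq_free_of_apply_eq_zero hAB hAν hAf hBν hBf hνf hrm hrf'] at hℓf'
  have hℓ₀f : ℓ k f = 0 := hℓf k le_rfl hrk
  have hℓ₁f : ℓ (k + 1) f = 0 := hℓf (k + 1) (by omega) hrk1
  have hℓ₀A : ℓ k A = 0 := by
    have hd := hdir k le_rfl
    rw [hjA, hbk] at hd
    exact apply_eq_zero_of_direction_of_apply_eq_zero hℓ₀f hd
  have hs₁ : c (k + 1) = CentreBlowup.step 5 Finset.univ A (Pi.single f (b k f)) (c k) := by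
    rw [(hw k).2.2.2.2, hjA, ← hbk]
  have ho₀ : ordZero (c k).F = 6 := by rw [hord k le_rfl]; rfl
  have ho₁ : ordZero (c (k + 1)).F = 6 := by rw [hord (k + 1) (by omega)]; rfl
  -- step `k + 1` is satellite: chart `B` or the rotation losing `B`
  obtain ⟨hjne, hbA⟩ := hsat
  rw [hjA] at hjne hbA
  rcases slot_or_free hAB hAν hAf hBν hBf hνf (hidle (k + 1) (by omega)).2.1 with hj1 | hj1
  · -- slot step at `k + 1`: chart `B`
    have hjB : j (k + 1) = B := by
      rcases hj1 with h | h
      · exact absurd h hjne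
      · exact h
    obtain ⟨-, hbk1⟩ := r_succ_of_slot' 5 hw (hord (k + 1) (by omega)) (hdeg (k + 1) (by omega)) hAB hAν hAf
      hBν hBf hνf hrk1 (Or.inr hjB)
    have hℓ₁B : ℓ (k + 1) B = 0 := by
      have hd := hdir (k + 1) (by omega)
      rw [hjB, hbk1] at hd
      exact apply_eq_zero_of_direction_of_apply_eq_zero hℓ₁f hd
    have hs₂ : c (k + 2) = CentreBlowup.step 5 Finset.univ B (Pi.single f (b (k + 1) f)) (c (k + 1)) := by
      rw [show k + 2 = (k + 1) + 1 by omega, (hw (k + 1)).2.2.2.2, hjB, ← hbk1]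
    exact not_isIsolated_after_lSector_change_of_forms hAB hAν hAf hBν hBf hνf (c k) (b k f) (b (k + 1) f) ho₀
      (hdiv k) hrk (hform k le_rfl) hℓ₀A hℓ₀f hs₁ ho₁ (hdiv (k + 1)) hrk1 (hform (k + 1) (by omega)) hℓ₁B hℓ₁f
      hs₂ hiso
  · -- rotation at `k + 1`: it loses `B` (the satellite condition spares `A`)
    rcases r_succ_of_rotation 5 hw (hord (k + 1) (by omega)) (hdeg (k + 1) (by omega)) hAB hAν hAf hBν hBf hνf
      hrk1 hj1 (hidle (k + 1) (by omega)).2.2 with ⟨hbA', -, -⟩ | ⟨hbB, hbs, -⟩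
    · exact hbA' hbA
    have hℓ₁B : ℓ (k + 1) B = 0 := by
      have hd := hdir (k + 1) (by omega)
      rw [hj1, hℓ₁f, zero_add, hbs, dotProduct_single] at hd
      rcases mul_eq_zero.mp hd with h | h
      · exact h
      · exact absurd h hbB
    have hs₂ : c (k + 2) = CentreBlowup.step 5 Finset.univ f (Pi.single B (b (k + 1) B)) (c (k + 1)) := by
      rw [show k + 2 = (k + 1) + 1 by omega, (hw (k + 1)).2.2.2.2, hj1, ← hbs]
    exact not_isIsolated_after_slot_rotation_of_forms hAB hAν hAf hBν hBf hνf (c k) (b k f) (b (k + 1) B) ho₀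
      (hdiv k) hrk (hform k le_rfl) hℓ₀A hℓ₀f hs₁ ho₁ (hdiv (k + 1)) hrk1 (hform (k + 1) (by omega)) hℓ₁B hℓ₁f
      hs₂ hiso

/-- **DEATH AFTER A ROTATION.**  Same regime; a ROTATION step `k` (chart the free letter `f`) losing the slot `A`
followed by a SATELLITE step `k+1` (`j (k+1) ≠ f`, `b (k+1) f = 0`) makes `c (k+2)` non-isolated: the direction
equations give `ℓ_k A = 0` (rotation), `ℓ_{k+1} A = λ_k ℓ_k A = 0` (the new free letter), `ℓ_{k+1} B = 0` (step `k+1`: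
slot `B` translated along `A`, or rotation chart `A` losing `B`) and back `ℓ_k B = 0` (`λ_k ≠ 0`) — so
`cone_k = c·x_ν³` — and R2b (iii)/(iv) `not_isIsolated_after_rotation_step_of_forms` applies. [OURS]
[cite: CossartJannsenSaito2020, Thm. 3.14] -/
theorem false_of_rotation_satellite_L {c : ℕ → State K} {j : ℕ → Fin 4} {b : ℕ → Fin 4 → K}
    (hw : FreeTail.IsWitnessedChain 5 c j b) {k : ℕ}
    (hord : ∀ m, k ≤ m → ordZero (c m).F = ((6 : ℕ) : ℕ∞))
    (hwt : ∀ m, k ≤ m → (∀ i, (c m).r i ≤ 1) ∧ (c m).r.degree = 3)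
    (hdiv : ∀ m, ∀ d ∈ (c m).F.support, (c m).r ≤ d) {ν : Fin 4}
    (hidle : ∀ m, k ≤ m → 1 ≤ (c m).r ν ∧ j m ≠ ν ∧ b m ν = 0) {ℓ : ℕ → Fin 4 → K} {a0 lam : ℕ → K}
    (hform : ∀ m, k ≤ m → resForm (c m) = C (a0 m) * (∑ i, C (ℓ m i) * X i) ^ 3)
    (hdir : ∀ m, k ≤ m → ℓ m (j m) + dotProduct (ℓ m) (b m) = 0)
    (hlam : ∀ m, k ≤ m → lam m ≠ 0) (hprop : ∀ m, k ≤ m → ∀ i, i ≠ j m → ℓ (m + 1) i = lam m * ℓ m i)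
    (hfree : ∀ m, k ≤ m → ∃ f, (c m).r f = 0 ∧ ℓ m f = 0)
    (hiso : IsIsolated 5 (c (k + 2)).F) {A B f : Fin 4} (hAB : A ≠ B) (hAν : A ≠ ν) (hAf : A ≠ f)
    (hBν : B ≠ ν) (hBf : B ≠ f) (hνf : ν ≠ f)
    (hrk : (c k).r = Finsupp.single A 1 + Finsupp.single B 1 + Finsupp.single ν 1) (hjf : j k = f)
    (hbA : b k A ≠ 0) (hsat : FreeTail.IsSatellite j b k) : False := by
  have hdeg : ∀ m, k ≤ m → (c (m + 1)).r.degree = (c m).r.degree := fun m hm => by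
    rw [(hwt (m + 1) (by omega)).2, (hwt m hm).2]
  -- step `k`: rotation losing `A`
  rcases r_succ_of_rotation 5 hw (hord k le_rfl) (hdeg k le_rfl) hAB hAν hAf hBν hBf hνf hrk hjf
    (hidle k le_rfl).2.2 with ⟨-, hbs, hrk1⟩ | ⟨-, hbs, -⟩
  swap
  · rw [hbs, Pi.single_eq_of_ne hAB] at hbA
    exact hbA rfl
  -- the letters at `k + 1`: slots `f`, `B`; free `A`
  have hfB : f ≠ B := hBf.symm
  have hfν : f ≠ ν := hνf.symm
  have hfA : f ≠ A := hAf.symm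
  have hBA : B ≠ A := hAB.symm
  have hνA : ν ≠ A := hAν.symm
  -- vanishing of the forms
  have hℓ₀f : ℓ k f = 0 := by
    obtain ⟨f', hrf', hℓf'⟩ := hfree k le_rfl
    rwa [eq_free_of_apply_eq_zero hAB hAν hAf hBν hBf hνf hrk hrf'] at hℓf'
  have hℓ₀A : ℓ k A = 0 := by
    have hd := hdir k le_rfl
    rw [hjf, hℓ₀f, zero_add, hbs, dotProduct_single] at hd
    rcases mul_eq_zero.mp hd with h | h
    · exact h
    · exact absurd h hbA
  have hℓ₁A : ℓ (k + 1) A = 0 := by rw [hprop k le_rfl A (by rw [hjf]; exact hAf), hℓ₀A, mul_zero]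
  have hℓ₀B_of : ℓ (k + 1) B = 0 → ℓ k B = 0 := fun h => by
    rw [hprop k le_rfl B (by rw [hjf]; exact hBf)] at h
    rcases mul_eq_zero.mp h with h' | h'
    · exact absurd h' (hlam k le_rfl)
    · exact h'
  have hs₁ : c (k + 1) = CentreBlowup.step 5 Finset.univ f (Pi.single A (b k A)) (c k) := by
    rw [(hw k).2.2.2.2, hjf, ← hbs]
  have ho₀ : ordZero (c k).F = 6 := by rw [hord k le_rfl]; rfl
  have ho₁ : ordZero (c (k + 1)).F = 6 := by rw [hord (k + 1) (by omega)]; rfl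
  -- step `k + 1` is satellite: chart `B` (slot, along `A`) or chart `A` (rotation losing `B`)
  obtain ⟨hjne, hbf1⟩ := hsat
  rw [hjf] at hjne hbf1
  rcases slot_or_free hfB hfν hfA hBν hBA hνA (hidle (k + 1) (by omega)).2.1 with hj1 | hj1
  · -- slot step at `k + 1`: chart `B`, translation along the free letter `A`
    have hjB : j (k + 1) = B := by
      rcases hj1 with h | h
      · exact absurd h hjne
      · exact h
    obtain ⟨-, hbk1⟩ := r_succ_of_slot' 5 hw (hord (k + 1) (by omega)) (hdeg (k + 1) (by omega)) hfB hfν hfA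
      hBν hBA hνA hrk1 (Or.inr hjB)
    have hℓ₁B : ℓ (k + 1) B = 0 := by
      have hd := hdir (k + 1) (by omega)
      rw [hjB, hbk1] at hd
      exact apply_eq_zero_of_direction_of_apply_eq_zero hℓ₁A hd
    have hs₂ : c (k + 2) = CentreBlowup.step 5 Finset.univ B (Pi.single A (b (k + 1) A)) (c (k + 1)) := by
      rw [show k + 2 = (k + 1) + 1 by omega, (hw (k + 1)).2.2.2.2, hjB, ← hbk1]
    exact not_isIsolated_after_rotation_step_of_forms hAB hAν hAf hBν hBf hνf hBA hBf hBν hAf hAν (c k) (b k A)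
      (b (k + 1) A) ho₀ (hdiv k) hrk (hform k le_rfl) hℓ₀A (hℓ₀B_of hℓ₁B) hℓ₀f hs₁ ho₁ (hdiv (k + 1)) hrk1
      (hform (k + 1) (by omega)) hℓ₁A hℓ₁B hs₂ hiso
  · -- rotation at `k + 1`: chart `A`, it loses `B` (the satellite condition spares `f`)
    rcases r_succ_of_rotation 5 hw (hord (k + 1) (by omega)) (hdeg (k + 1) (by omega)) hfB hfν hfA hBν hBA hνA
      hrk1 hj1 (hidle (k + 1) (by omega)).2.2 with ⟨hbf', -, -⟩ | ⟨hbB, hbs1, -⟩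
    · exact hbf' hbf1
    have hℓ₁B : ℓ (k + 1) B = 0 := by
      have hd := hdir (k + 1) (by omega)
      rw [hj1, hℓ₁A, zero_add, hbs1, dotProduct_single] at hd
      rcases mul_eq_zero.mp hd with h | h
      · exact h
      · exact absurd h hbB
    have hs₂ : c (k + 2) = CentreBlowup.step 5 Finset.univ A (Pi.single B (b (k + 1) B)) (c (k + 1)) := by
      rw [show k + 2 = (k + 1) + 1 by omega, (hw (k + 1)).2.2.2.2, hj1, ← hbs1]
    exact not_isIsolated_after_rotation_step_of_forms hAB hAν hAf hBν hBf hνf hAB hAf hAν hBf hBν (c k) (b k A)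
      (b (k + 1) B) ho₀ (hdiv k) hrk (hform k le_rfl) hℓ₀A (hℓ₀B_of hℓ₁B) hℓ₀f hs₁ ho₁ (hdiv (k + 1)) hrk1
      (hform (k + 1) (by omega)) hℓ₁A hℓ₁B hs₂ hiso

end Kills

/-! ## 4. The L-sector branch of the two-slot tail, rotations included -/

section Main

variable [CharP K 5] [DecidableEq K]

/-- **THE L-SECTOR BRANCH OF THE TWO-SLOT TAIL IS EMPTY — ROTATIONS INCLUDED** (K24a-L′, the holder's booking
2026-08-29 04:35:53Z: p-1 g4's `no_twoSlot_tail_five_of_slot_L` WITHOUT `hslot`).  On a witnessed isolated above-floor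
`Step0 5` chain with `x^{r₀} ∣ F₀`, shade `3` and `e_G = 3` from `k₀` on, an idle boundary letter `ν` from `k₁ ≥ k₀`
on, if at `k₁` some vertex form vanishes at a free letter then: weights are `≤ 1` with `|r| = 3` (K26a, else a free
tail ✗ FT), the L-sector persists through slot steps AND rotations (§2), a satellite step `k ≥ k₁` exists (FT,
`FreeTailProof.noIsolatedFreeTailAt_self 5`), and `c (k+2)` is not isolated (§3): contradiction.  No `hslot`, no
`hborn`, no `hT`. [OURS] [cite: CossartJannsenSaito2020, Thm. 3.14, Thm. 9.3] -/
theorem no_twoSlot_tail_five_L {c : ℕ → State K} {j : ℕ → Fin 4} {b : ℕ → Fin 4 → K}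
    (hc : ∀ k, IsIsolated 5 (c k).F ∧ Step0 5 (c k) (c (k + 1))) (hw : FreeTail.IsWitnessedChain 5 c j b)
    (hr0 : ∀ e ∈ (c 0).F.support, (c 0).r ≤ e) (hfloor : ∀ k, ordZero (c k).F ≠ (5 : ℕ)) {k₀ : ℕ}
    (hshade : ∀ k, k₀ ≤ k → (c k).shade = ((3 : ℕ) : ℕ∞))
    (he3 : ∀ k, k₀ ≤ k → Module.finrank K (resVertex (c k)) = 3) {ν : Fin 4} {k₁ : ℕ} (hk₁ : k₀ ≤ k₁)
    (hidle : ∀ k, k₁ ≤ k → 1 ≤ (c k).r ν ∧ j k ≠ ν ∧ b k ν = 0)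
    (hL : ∃ ℓ' : Fin 4 → K, (∀ w, w ∈ resVertex (c k₁) ↔ dotProduct ℓ' w = 0) ∧
      ∃ i, (c k₁).r i = 0 ∧ ℓ' i = 0) :
    False := by
  haveI : Fact (Nat.Prime 5) := ⟨by norm_num⟩
  -- the frame data of the power-cone stretch
  obtain ⟨ℓ, a0, lam, hpkg⟩ := chain_powerCone_package 5 hc hw hr0 hfloor (by norm_num) hshade he3
  have hV : ∀ k, k₀ ≤ k → ∀ w, w ∈ resVertex (c k) ↔ dotProduct (ℓ k) w = 0 := fun k hk => (hpkg k hk).2.1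
  have hform : ∀ k, k₀ ≤ k → resForm (c k) = C (a0 k) * (∑ i, C (ℓ k i) * X i) ^ 3 :=
    fun k hk => (hpkg k hk).2.2.1
  have hdir : ∀ k, k₀ ≤ k → ℓ k (j k) + dotProduct (ℓ k) (b k) = 0 := fun k hk => (hpkg k hk).2.2.2.1
  have hlam : ∀ k, k₀ ≤ k → lam k ≠ 0 := fun k hk => (hpkg k hk).2.2.2.2.1
  have hprop : ∀ k, k₀ ≤ k → ∀ i, i ≠ j k → ℓ (k + 1) i = lam k * ℓ k i :=
    fun k hk => (hpkg k hk).2.2.2.2.2.1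
  have hcarry : ∀ k, k₀ ≤ k → ∃ i, i ≠ j k ∧ ℓ k i ≠ 0 := fun k hk => (hpkg k hk).2.2.2.2.2.2
  -- K27a's weights: free tail (✗ FT) or weights `≤ 1` with `|r| = 3`
  have hlight : ∀ k, k₀ ≤ k → FreeTail.IsSatellite j b k → ∀ oₖ oₖ₁ : ℕ,
      ordZero (c k).F = oₖ → ordZero (c (k + 1)).F = oₖ₁ → oₖ + oₖ₁ + 3 ≤ 15 := by
    intro k hk hsat oₖ oₖ₁ hoₖ hoₖ₁
    have h := satellite_light_of_powerCone 5 hc hw hr0 hfloor (by norm_num) (by norm_num) hshade hform hdir hlam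
      hprop hcarry hk hsat hoₖ hoₖ₁
    omega
  have hfloor' : ∀ k, ordZero (c k).F ≠ 5 := fun k => by have h := hfloor k; exact_mod_cast h
  have hFT : ∀ k₂, (∀ k, k₂ ≤ k → ¬ FreeTail.IsSatellite j b k) → False := fun k₂ hfree => by
    obtain ⟨k, hk⟩ := FreeTailProof.noIsolatedFreeTailAt_self 5 K c j b k₂ hw hfree
    exact hk (hc k).1
  rcases light_weights hc hw hfloor' hshade hlight with ⟨k₂, -, hfree⟩ | hwt
  · exact hFT k₂ hfree
  -- orders `6`, `x^r ∣ F`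
  have hord : ∀ k, k₀ ≤ k → ordZero (c k).F = ((6 : ℕ) : ℕ∞) := by
    intro k hk
    obtain ⟨o, ho, -, -, hod⟩ := chain_shade_nat 5 hc hfloor hshade hk
    rw [ho, (hwt k hk).2] at *
    have : o = 6 := by omega
    rw [this]
  have hdivk := IsolatedBand.isolated_chain_forall_le hc hr0
  -- the L-sector at `k₁`, and for ever (rotations included)
  have hL₁ : ∃ f, (c k₁).r f = 0 ∧ ℓ k₁ f = 0 := by
    obtain ⟨ℓ', hV', i, hri, hℓ'i⟩ := hL
    exact ⟨i, hri, apply_eq_zero_of_kernel_iff (hV k₁ hk₁) hV' hℓ'i⟩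
  have hfree := lSector_persists_rot 5 hw (k₁ := k₁) (fun k hk => hord k (hk₁.trans hk))
    (fun k hk => hwt k (hk₁.trans hk)) hidle (fun k hk => hdir k (hk₁.trans hk))
    (fun k hk => hprop k (hk₁.trans hk)) hL₁
  -- a satellite step `k ≥ k₁`
  by_contra -
  refine hFT k₁ fun k hk hsat => ?_
  -- the letters at `k`
  have hν1 : (c k).r ν = 1 := le_antisymm ((hwt k (hk₁.trans hk)).1 ν) (hidle k hk).1
  obtain ⟨A, B, f, hAB, hAν, hAf, hBν, hBf, hνf, hrk⟩ :=
    exists_slot_letters (hwt k (hk₁.trans hk)).1 (hwt k (hk₁.trans hk)).2 hν1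
  have hord' : ∀ m, k ≤ m → ordZero (c m).F = ((6 : ℕ) : ℕ∞) := fun m hm => hord m (by omega)
  have hwt' : ∀ m, k ≤ m → (∀ i, (c m).r i ≤ 1) ∧ (c m).r.degree = 3 := fun m hm => hwt m (by omega)
  have hidle' : ∀ m, k ≤ m → 1 ≤ (c m).r ν ∧ j m ≠ ν ∧ b m ν = 0 := fun m hm => hidle m (by omega)
  have hform' : ∀ m, k ≤ m → resForm (c m) = C (a0 m) * (∑ i, C (ℓ m i) * X i) ^ 3 :=
    fun m hm => hform m (by omega)
  have hdir' : ∀ m, k ≤ m → ℓ m (j m) + dotProduct (ℓ m) (b m) = 0 := fun m hm => hdir m (by omega)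
  have hlam' : ∀ m, k ≤ m → lam m ≠ 0 := fun m hm => hlam m (by omega)
  have hprop' : ∀ m, k ≤ m → ∀ i, i ≠ j m → ℓ (m + 1) i = lam m * ℓ m i := fun m hm => hprop m (by omega)
  have hfree' : ∀ m, k ≤ m → ∃ f, (c m).r f = 0 ∧ ℓ m f = 0 := fun m hm => hfree m (by omega)
  rcases slot_or_free hAB hAν hAf hBν hBf hνf (hidle k hk).2.1 with (hjk | hjk) | hjk
  · -- slot `A`
    exact false_of_slot_satellite_L hw hord' hwt' hdivk hidle' hform' hdir' hfree' (hc (k + 2)).1 hAB hAν hAf hBν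
      hBf hνf hrk hjk hsat
  · -- slot `B`: the same with `A ↔ B`
    exact false_of_slot_satellite_L hw hord' hwt' hdivk hidle' hform' hdir' hfree' (hc (k + 2)).1 hAB.symm hBν hBf
      hAν hAf hνf (by rw [hrk]; abel) hjk hsat
  · -- rotation: it loses `A` or `B`
    have hdeg : (c (k + 1)).r.degree = (c k).r.degree := by
      rw [(hwt (k + 1) (by omega)).2, (hwt k (hk₁.trans hk)).2]
    rcases r_succ_of_rotation 5 hw (hord k (hk₁.trans hk)) hdeg hAB hAν hAf hBν hBf hνf hrk hjk (hidle k hk).2.2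
      with ⟨hbA, -, -⟩ | ⟨hbB, -, -⟩
    · exact false_of_rotation_satellite_L hw hord' hwt' hdivk hidle' hform' hdir' hlam' hprop' hfree' (hc (k + 2)).1
        hAB hAν hAf hBν hBf hνf hrk hjk hbA hsat
    · exact false_of_rotation_satellite_L hw hord' hwt' hdivk hidle' hform' hdir' hlam' hprop' hfree' (hc (k + 2)).1
        hAB.symm hBν hBf hAν hAf hνf (by rw [hrk]; abel) hjk hbB hsat

/-- **(T2) IS DEAD MODULO T-SECTOR ROTATIONS ONLY** (res-dim4-p-1 g4's request, bus 2026-08-29 04:53:16Z): the (T2)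
configuration — idle `ν`, born slot letters — is contradictory as soon as, IN THE T-SECTOR at `k₁` (every vertex form
charges every free letter), no rotation step occurs from `k₁` on (`hslotT`): T-sector = p-1 g4's `no_twoSlot_tail_five_of_slot`
with `hslot := hslotT hT`, L-sector = `no_twoSlot_tail_five_L`. [OURS · conditional on the named residual `hslotT` (R1′)]
[cite: CossartJannsenSaito2020, Thm. 3.14, Thm. 9.3] -/
theorem no_twoSlot_tail_five_of_slotT {c : ℕ → State K} {j : ℕ → Fin 4} {b : ℕ → Fin 4 → K}
    (hc : ∀ k, IsIsolated 5 (c k).F ∧ Step0 5 (c k) (c (k + 1))) (hw : FreeTail.IsWitnessedChain 5 c j b)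
    (hr0 : ∀ e ∈ (c 0).F.support, (c 0).r ≤ e) (hfloor : ∀ k, ordZero (c k).F ≠ (5 : ℕ)) {k₀ : ℕ}
    (hshade : ∀ k, k₀ ≤ k → (c k).shade = ((3 : ℕ) : ℕ∞))
    (he3 : ∀ k, k₀ ≤ k → Module.finrank K (resVertex (c k)) = 3) {ν : Fin 4} {k₁ : ℕ} (hk₁ : k₀ ≤ k₁)
    (hidle : ∀ k, k₁ ≤ k → 1 ≤ (c k).r ν ∧ j k ≠ ν ∧ b k ν = 0)
    (hborn : ∀ k, k₁ ≤ k → ∀ i, i ≠ ν → 1 ≤ (c k).r i →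
      ∃ t, k₀ ≤ t ∧ t < k ∧ j t = i ∧ ∀ m, t < m → m < k → j m ≠ i ∧ b m i = 0)
    (hslotT : (∀ ℓ : Fin 4 → K, (∀ w, w ∈ resVertex (c k₁) ↔ dotProduct ℓ w = 0) →
        ∀ i, (c k₁).r i = 0 → ℓ i ≠ 0) → ∀ k, k₁ ≤ k → 1 ≤ (c k).r (j k)) :
    False := by
  by_cases hT : ∀ ℓ : Fin 4 → K, (∀ w, w ∈ resVertex (c k₁) ↔ dotProduct ℓ w = 0) → ∀ i, (c k₁).r i = 0 → ℓ i ≠ 0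
  · exact no_twoSlot_tail_five_of_slot hc hw hr0 hfloor hshade he3 hk₁ hidle hborn (hslotT hT) hT
  · push Not at hT
    exact no_twoSlot_tail_five_L hc hw hr0 hfloor hshade he3 hk₁ hidle hT

/-! ## 5. The residual of the light `d = 3` tail is the T-sector -/

/-- **K27a's RESIDUAL IS THE T-SECTOR.**  `no_light_powerCone_tail_three_five_of` (K27a) with its hypothesis `hT2`
reduced by `no_twoSlot_tail_five_L`: it now suffices to kill the (T2) configuration when, at `k₁`, EVERY vertex form
charges every free letter (the T-sector; rotations still allowed — res-dim4-p-1's R1′). [OURS · conditional on the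
one named residual hypothesis `hT`] [cite: CossartJannsenSaito2020, Thm. 3.10(4), Thm. 3.14, Thm. 9.3] -/
theorem no_light_powerCone_tail_three_five_of_T {c : ℕ → State K} {j : ℕ → Fin 4} {b : ℕ → Fin 4 → K}
    (hc : ∀ k, IsIsolated 5 (c k).F ∧ Step0 5 (c k) (c (k + 1))) (hw : FreeTail.IsWitnessedChain 5 c j b)
    (hr0 : ∀ e ∈ (c 0).F.support, (c 0).r ≤ e) (hfloor : ∀ k, ordZero (c k).F ≠ (5 : ℕ)) {k₀ : ℕ}
    (hshade : ∀ k, k₀ ≤ k → (c k).shade = ((3 : ℕ) : ℕ∞))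
    (he3 : ∀ k, k₀ ≤ k → Module.finrank K (resVertex (c k)) = 3)
    (hT : ∀ (ν : Fin 4) (k₁ : ℕ), k₀ ≤ k₁ → (∀ k, k₁ ≤ k → 1 ≤ (c k).r ν ∧ j k ≠ ν ∧ b k ν = 0) →
      (∀ k, k₁ ≤ k → ∀ i, i ≠ ν → 1 ≤ (c k).r i →
        ∃ t, k₀ ≤ t ∧ t < k ∧ j t = i ∧ ∀ m, t < m → m < k → j m ≠ i ∧ b m i = 0) →
      (∀ ℓ : Fin 4 → K, (∀ w, w ∈ resVertex (c k₁) ↔ dotProduct ℓ w = 0) →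
        ∀ i, (c k₁).r i = 0 → ℓ i ≠ 0) → False) : False :=
  no_light_powerCone_tail_three_five_of hc hw hr0 hfloor hshade he3 fun ν k₁ hk₁ hidle hborn => by
    by_cases hT' : ∀ ℓ : Fin 4 → K, (∀ w, w ∈ resVertex (c k₁) ↔ dotProduct ℓ w = 0) →
        ∀ i, (c k₁).r i = 0 → ℓ i ≠ 0
    · exact hT ν k₁ hk₁ hidle hborn hT'
    · push Not at hT'
      exact no_twoSlot_tail_five_L hc hw hr0 hfloor hshade he3 hk₁ hidle hT'

/-- **THE LIGHT `d = 3` TAIL AT `p = 5` IS EMPTY MODULO T-SECTOR ROTATIONS** (K27a dress of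
`no_twoSlot_tail_five_of_slotT`): K27a's `hT2` shrunk to «in the T-sector at `k₁`, no rotation step from `k₁` on».
[OURS · conditional on the named residual `hslotT` (R1′)] [cite: CossartJannsenSaito2020, Thm. 3.10(4), Thm. 3.14, Thm. 9.3] -/
theorem no_light_powerCone_tail_three_five_of_slotT {c : ℕ → State K} {j : ℕ → Fin 4} {b : ℕ → Fin 4 → K}
    (hc : ∀ k, IsIsolated 5 (c k).F ∧ Step0 5 (c k) (c (k + 1))) (hw : FreeTail.IsWitnessedChain 5 c j b)
    (hr0 : ∀ e ∈ (c 0).F.support, (c 0).r ≤ e) (hfloor : ∀ k, ordZero (c k).F ≠ (5 : ℕ)) {k₀ : ℕ}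
    (hshade : ∀ k, k₀ ≤ k → (c k).shade = ((3 : ℕ) : ℕ∞))
    (he3 : ∀ k, k₀ ≤ k → Module.finrank K (resVertex (c k)) = 3)
    (hslotT : ∀ (ν : Fin 4) (k₁ : ℕ), k₀ ≤ k₁ → (∀ k, k₁ ≤ k → 1 ≤ (c k).r ν ∧ j k ≠ ν ∧ b k ν = 0) →
      (∀ k, k₁ ≤ k → ∀ i, i ≠ ν → 1 ≤ (c k).r i →
        ∃ t, k₀ ≤ t ∧ t < k ∧ j t = i ∧ ∀ m, t < m → m < k → j m ≠ i ∧ b m i = 0) →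
      (∀ ℓ : Fin 4 → K, (∀ w, w ∈ resVertex (c k₁) ↔ dotProduct ℓ w = 0) →
        ∀ i, (c k₁).r i = 0 → ℓ i ≠ 0) → ∀ k, k₁ ≤ k → 1 ≤ (c k).r (j k)) : False :=
  no_light_powerCone_tail_three_five_of hc hw hr0 hfloor hshade he3 fun ν k₁ hk₁ hidle hborn =>
    no_twoSlot_tail_five_of_slotT hc hw hr0 hfloor hshade he3 hk₁ hidle hborn (hslotT ν k₁ hk₁ hidle hborn)

end Main

end ResCone

end Summit.ResolutionOfSingularities.ResolutionOfSingularities.Theorems.PIDim4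

end
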